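import Summits.Ventures.HodgeRepro2.T5SU11LegendreHeineBounds
import Mathlib.Algebra.Order.Field.GeomSum

/-!
# The Laplace–Heine asymptotic: `√n · e^{−2nt} · P_n(cosh 2t) → 1/√(π(1 − e^{−4t}))` for `t > 0`

Heine's expansion (`T5SU11LegendreHeine.exp_neg_mul_legP_cosh_eq`) writes `e^{−2nt} P_n(cosh 2t) = Σ_{j≤n} a_{n−j} a_j zʲ`
with `z = e^{−4t} ∈ (0, 1)` and `a_k = C(2k,k)/4^k`. Dividing by the leading coefficient `a_n`,

  `T_n := (1/a_n) Σ_{j≤n} a_{n−j} a_j zʲ → Σ_j a_j zʲ = (1 − z)^{−1/2}`   (`tendsto_heineRatio`, `tsum_binomHalf_mul_pow`),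

by an ε-argument with three blocks: `j < m` (where `a_{n−j}/a_n → 1` uniformly, `binomHalf_div_le_pow`), `m ≤ j ≤ n/2`
(where `a_{n−j}/a_n ≤ 2`, `binomHalf_div_le_two`, and the geometric tail `2 zᵐ/(1 − z)` is small), and `j > n/2` (where
`a_{n−j}/a_n ≤ 2√n ≤ 2n` and `n z^{n/2} → 0`); the elementary two-sided bounds `1/(4k) ≤ a_k² ≤ 1/(2k + 1)`
(`T5SU11LegendreHeineBounds.le_binomHalf_sq`, `binomHalf_sq_le`) drive the last two. With Stirling's `√n a_n → 1/√π`
(`T5SU11LegendreCentralBinomial.tendsto_sqrt_mul_binomHalf`):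

  **`√n · e^{−2nt} · P_n(cosh 2t) → 1/√(π (1 − e^{−4t}))`**   (`tendsto_sqrt_mul_exp_neg_mul_legP_cosh`),

i.e. `P_n(cosh ξ) ∼ e^{(n+½)ξ}/√(2πn sinh ξ)` with `ξ = 2t` — the Laplace–Heine formula — and on the group
**`√n · e^{−2nt} · φ_{2n+2}(a_t) → 1/√(π(1 − e^{−4t}))`** (`tendsto_sqrt_mul_exp_neg_mul_sph_even_hyp`): the sharp
asymptotic of the spherical functions of even parameter in the parameter, at every `t > 0`. Nothing is claimed about (N).

Blind lane: Mathlib + the HodgeRepro2 prefix only; no sorry; axioms ⊆ {propext, Classical.choice,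
Quot.sound}.
-/

namespace Summit.Ventures.HodgeRepro2.T5SU11LegendreLaplaceHeine

open Filter Topology Finset
open T5SU11Cartan T5SU11SphericalFunction T5SU11SphericalLegendreAll T5SU11SphericalAsymptotic T5SU11LegendreHeine
  T5SU11LegendreCentralBinomial T5SU11LegendreHeineBounds

/-! ### The Heine ratio `T_n = (1/a_n) Σ_{j≤n} a_{n−j} a_j zʲ` -/

/-- **The Heine sum `S_n(z) = Σ_{j≤n} a_{n−j} a_j zʲ`** (`= e^{−2nt} P_n(cosh 2t)` at `z = e^{−4t}`). -/
noncomputable def heineSum (z : ℝ) (n : ℕ) : ℝ := ∑ j ∈ range (n + 1), binomHalf (n - j) * binomHalf j * z ^ j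

/-- `S_n/a_n = Σ_{j≤n} (a_{n−j}/a_n) · a_j zʲ`. -/
theorem heineSum_div (z : ℝ) (n : ℕ) :
    heineSum z n / binomHalf n
      = ∑ j ∈ range (n + 1), (binomHalf (n - j) / binomHalf n) * (binomHalf j * z ^ j) := by
  rw [heineSum, Finset.sum_div]
  refine Finset.sum_congr rfl fun j _ => ?_
  ring

/-- `Σ_j a_j zʲ` converges for `0 ≤ z < 1`. -/
theorem summable_binomHalf_mul_pow {z : ℝ} (hz0 : 0 ≤ z) (hz1 : z < 1) :
    Summable fun j : ℕ => binomHalf j * z ^ j :=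
  Summable.of_nonneg_of_le (fun j => by have := binomHalf_pos j; positivity)
    (fun j => mul_le_of_le_one_left (pow_nonneg hz0 j) (binomHalf_le_one j))
    (summable_geometric_of_lt_one hz0 hz1)

/-- **Lower bound**: `Σ_{j<m} a_j zʲ ≤ S_n/a_n` for `m ≤ n + 1` (`a_{n−j} ≥ a_n`). -/
theorem sum_le_heineSum_div {z : ℝ} (hz0 : 0 ≤ z) {m n : ℕ} (hmn : m ≤ n + 1) :
    ∑ j ∈ range m, binomHalf j * z ^ j ≤ heineSum z n / binomHalf n := by
  rw [heineSum_div]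
  have hterm : ∀ j ∈ range (n + 1),
      binomHalf j * z ^ j ≤ (binomHalf (n - j) / binomHalf n) * (binomHalf j * z ^ j) := fun j _ => by
    have h1 : 1 ≤ binomHalf (n - j) / binomHalf n := by
      rw [le_div_iff₀ (binomHalf_pos n), one_mul]
      exact binomHalf_antitone (Nat.sub_le n j)
    have h0 : 0 ≤ binomHalf j * z ^ j := by have := binomHalf_pos j; positivity
    nlinarith
  calc ∑ j ∈ range m, binomHalf j * z ^ j ≤ ∑ j ∈ range (n + 1), binomHalf j * z ^ j :=
        Finset.sum_le_sum_of_subset_of_nonneg (Finset.range_mono hmn)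
          (fun j _ _ => by have := binomHalf_pos j; positivity)
    _ ≤ ∑ j ∈ range (n + 1), (binomHalf (n - j) / binomHalf n) * (binomHalf j * z ^ j) :=
        Finset.sum_le_sum hterm

/-- **Upper bound** in three blocks (`j < m`, `m ≤ j ≤ n/2`, `n/2 < j ≤ n`): for `n ≥ 1`, `m ≤ n/2 + 1`,
`S_n/a_n ≤ (1 + 1/(2(n−m)+1))^m Σ_{j<m} a_j zʲ + 2 zᵐ/(1 − z) + 2n z^{n/2+1}/(1 − z)`. -/
theorem heineSum_div_le {z : ℝ} (hz0 : 0 ≤ z) (hz1 : z < 1) {m n : ℕ} (hn : 1 ≤ n) (hm : m ≤ n / 2 + 1) :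
    heineSum z n / binomHalf n
      ≤ (1 + 1 / (2 * ((n - m : ℕ) : ℝ) + 1)) ^ m * (∑ j ∈ range m, binomHalf j * z ^ j)
        + 2 * z ^ m / (1 - z) + 2 * (n : ℝ) * z ^ (n / 2 + 1) / (1 - z) := by
  rw [heineSum_div]
  set f : ℕ → ℝ := fun j => (binomHalf (n - j) / binomHalf n) * (binomHalf j * z ^ j) with hf
  have hsplit1 := Finset.sum_range_add_sum_Ico f (show m ≤ n + 1 by omega)
  have hsplit2 := Finset.sum_Ico_consecutive f (show m ≤ n / 2 + 1 by omega) (show n / 2 + 1 ≤ n + 1 by omega)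
  rw [← hsplit1, ← hsplit2]
  have h1z : 0 < 1 - z := by linarith
  -- block 1: `j < m`
  have hb1 : ∑ j ∈ range m, f j
      ≤ (1 + 1 / (2 * ((n - m : ℕ) : ℝ) + 1)) ^ m * ∑ j ∈ range m, binomHalf j * z ^ j := by
    rw [Finset.mul_sum]
    refine Finset.sum_le_sum fun j hj => ?_
    have hjm : j ≤ m := (Finset.mem_range.mp hj).le
    have hmn : m ≤ n := by omega
    exact mul_le_mul_of_nonneg_right (binomHalf_div_le_pow hjm hmn) (by have := binomHalf_pos j; positivity)
  -- block 2: `m ≤ j ≤ n/2`, ratio `≤ 2`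
  have hb2 : ∑ j ∈ Ico m (n / 2 + 1), f j ≤ 2 * z ^ m / (1 - z) := by
    calc ∑ j ∈ Ico m (n / 2 + 1), f j ≤ ∑ j ∈ Ico m (n / 2 + 1), 2 * z ^ j := by
          refine Finset.sum_le_sum fun j hj => ?_
          have hj2 : j ≤ n / 2 := by have := (Finset.mem_Ico.mp hj).2; omega
          have hr := binomHalf_div_le_two hn hj2
          have ha := binomHalf_le_one j
          have hz : 0 ≤ z ^ j := pow_nonneg hz0 j
          have h0 : 0 ≤ binomHalf (n - j) / binomHalf n := by
            have := binomHalf_pos (n - j); have := binomHalf_pos n; positivity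
          have hb := binomHalf_pos j
          calc (binomHalf (n - j) / binomHalf n) * (binomHalf j * z ^ j) ≤ 2 * (1 * z ^ j) :=
                mul_le_mul hr (mul_le_mul_of_nonneg_right ha hz) (by positivity) (by norm_num)
            _ = 2 * z ^ j := by ring
      _ = 2 * ∑ j ∈ Ico m (n / 2 + 1), z ^ j := by rw [Finset.mul_sum]
      _ ≤ 2 * (z ^ m / (1 - z)) :=
          mul_le_mul_of_nonneg_left (geom_sum_Ico_le_of_lt_one hz0 hz1) (by norm_num)
      _ = 2 * z ^ m / (1 - z) := by ring
  -- block 3: `n/2 < j ≤ n`, ratio `≤ 2√n ≤ 2n`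
  have hb3 : ∑ j ∈ Ico (n / 2 + 1) (n + 1), f j ≤ 2 * (n : ℝ) * z ^ (n / 2 + 1) / (1 - z) := by
    have hn' : (1 : ℝ) ≤ n := by exact_mod_cast hn
    have hsn : Real.sqrt (n : ℝ) ≤ n := by
      calc Real.sqrt (n : ℝ) ≤ Real.sqrt ((n : ℝ) ^ 2) := Real.sqrt_le_sqrt (by nlinarith)
        _ = n := Real.sqrt_sq (by positivity)
    calc ∑ j ∈ Ico (n / 2 + 1) (n + 1), f j ≤ ∑ j ∈ Ico (n / 2 + 1) (n + 1), 2 * (n : ℝ) * z ^ j := by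
          refine Finset.sum_le_sum fun j _ => ?_
          have hr : binomHalf (n - j) / binomHalf n ≤ 2 * (n : ℝ) :=
            (binomHalf_div_le_sqrt (j := j) hn).trans (by linarith)
          have ha := binomHalf_le_one j
          have hz : 0 ≤ z ^ j := pow_nonneg hz0 j
          have h0 : 0 ≤ binomHalf (n - j) / binomHalf n := by
            have := binomHalf_pos (n - j); have := binomHalf_pos n; positivity
          have hb := binomHalf_pos j
          calc (binomHalf (n - j) / binomHalf n) * (binomHalf j * z ^ j) ≤ 2 * (n : ℝ) * (1 * z ^ j) :=
                mul_le_mul hr (mul_le_mul_of_nonneg_right ha hz) (by positivity) (by positivity)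
            _ = 2 * (n : ℝ) * z ^ j := by ring
      _ = 2 * (n : ℝ) * ∑ j ∈ Ico (n / 2 + 1) (n + 1), z ^ j := by rw [Finset.mul_sum]
      _ ≤ 2 * (n : ℝ) * (z ^ (n / 2 + 1) / (1 - z)) :=
          mul_le_mul_of_nonneg_left (geom_sum_Ico_le_of_lt_one hz0 hz1) (by positivity)
      _ = 2 * (n : ℝ) * z ^ (n / 2 + 1) / (1 - z) := by ring
  linarith [hb1, hb2, hb3]

/-- **`S_n/a_n → Σ_j a_j zʲ`** for `0 < z < 1`. -/
theorem tendsto_heineSum_div {z : ℝ} (hz0 : 0 < z) (hz1 : z < 1) :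
    Tendsto (fun n => heineSum z n / binomHalf n) atTop (𝓝 (∑' j : ℕ, binomHalf j * z ^ j)) := by
  set L := ∑' j : ℕ, binomHalf j * z ^ j with hL
  have hsum := summable_binomHalf_mul_pow hz0.le hz1
  have hpartial : Tendsto (fun m => ∑ j ∈ range m, binomHalf j * z ^ j) atTop (𝓝 L) :=
    hsum.hasSum.tendsto_sum_nat
  have hL0 : 0 ≤ L := tsum_nonneg fun j => by have := binomHalf_pos j; positivity
  have h1z : 0 < 1 - z := by linarith
  rw [Metric.tendsto_atTop]
  intro ε hε
  -- the cut `m`: the partial sum within `ε/4` of `L` and the geometric tail `2zᵐ/(1−z) < ε/4`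
  have h1 : ∀ᶠ m in atTop, L - ε / 4 < ∑ j ∈ range m, binomHalf j * z ^ j :=
    hpartial.eventually_const_lt (by linarith)
  have h2 : ∀ᶠ m in atTop, 2 * z ^ m / (1 - z) < ε / 4 := by
    have : Tendsto (fun m : ℕ => 2 * z ^ m / (1 - z)) atTop (𝓝 (2 * 0 / (1 - z))) :=
      ((tendsto_pow_atTop_nhds_zero_of_lt_one hz0.le hz1).const_mul 2).div_const _
    rw [mul_zero, zero_div] at this
    exact this.eventually_lt_const (by linarith)
  obtain ⟨m, hm1, hm2⟩ := (h1.and h2).exists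
  have hSm : ∑ j ∈ range m, binomHalf j * z ^ j ≤ L :=
    hsum.sum_le_tsum _ fun j _ => by have := binomHalf_pos j; positivity
  have hS0 : 0 ≤ ∑ j ∈ range m, binomHalf j * z ^ j :=
    Finset.sum_nonneg fun j _ => by have := binomHalf_pos j; positivity
  -- the threshold `N`: the ratio factor within `ε/(4(L+1))` of `1`, the far tail `< ε/4`, and `n ≥ 2m + 2`
  have h3 : ∀ᶠ n in atTop, (1 + 1 / (2 * ((n - m : ℕ) : ℝ) + 1)) ^ m < 1 + ε / (4 * (L + 1)) :=
    (tendsto_one_add_pow m).eventually_lt_const (by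
      have : 0 < ε / (4 * (L + 1)) := by positivity
      linarith)
  have h4 : ∀ᶠ n : ℕ in atTop, 2 * (n : ℝ) * z ^ (n / 2 + 1) / (1 - z) < ε / 4 := by
    have : Tendsto (fun n : ℕ => 2 * (n : ℝ) * z ^ (n / 2 + 1) / (1 - z)) atTop (𝓝 (2 * 0 * z / (1 - z))) := by
      have := (((tendsto_mul_pow_div_two hz0 hz1).const_mul 2).mul_const z).div_const (1 - z)
      refine this.congr fun n => ?_
      rw [pow_succ]
      ring
    simp only [mul_zero, zero_mul, zero_div] at this
    exact this.eventually_lt_const (by linarith)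
  have h5 : ∀ᶠ n in atTop, 2 * m + 2 ≤ n := eventually_ge_atTop _
  obtain ⟨N, hN⟩ := eventually_atTop.mp ((h3.and h4).and h5)
  refine ⟨N, fun n hn => ?_⟩
  obtain ⟨⟨hn3, hn4⟩, hn5⟩ := hN n hn
  have hn1 : 1 ≤ n := by omega
  have hmn : m ≤ n / 2 + 1 := by omega
  rw [Real.dist_eq, abs_lt]
  have hlow := sum_le_heineSum_div hz0.le (z := z) (m := m) (n := n) (by omega)
  have hup := heineSum_div_le hz0.le hz1 hn1 hmn
  constructor
  · linarith
  · have hc0 : 0 ≤ (1 + 1 / (2 * ((n - m : ℕ) : ℝ) + 1)) ^ m := by positivity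
    have hprod : (1 + 1 / (2 * ((n - m : ℕ) : ℝ) + 1)) ^ m * ∑ j ∈ range m, binomHalf j * z ^ j
        ≤ (1 + ε / (4 * (L + 1))) * L :=
      mul_le_mul hn3.le hSm hS0 (by positivity)
    have hεL : ε / (4 * (L + 1)) * L ≤ ε / 4 := by
      rw [div_mul_eq_mul_div, div_le_div_iff₀ (by positivity) (by norm_num)]
      nlinarith
    have e : (1 + ε / (4 * (L + 1))) * L = L + ε / (4 * (L + 1)) * L := by ring
    linarith

/-! ### `Σ_j a_j zʲ = (1 − z)^{−1/2}` -/

/-- **`Σ_j a_j zʲ = 1/√(1 − z)`** for `0 ≤ z < 1` (the Cauchy product with `Σ_{i+j=n} a_i a_j = 1`). -/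
theorem tsum_binomHalf_mul_pow {z : ℝ} (hz0 : 0 ≤ z) (hz1 : z < 1) :
    ∑' j : ℕ, binomHalf j * z ^ j = 1 / Real.sqrt (1 - z) := by
  set L := ∑' j : ℕ, binomHalf j * z ^ j with hL
  have hsum := summable_binomHalf_mul_pow hz0 hz1
  have hnorm : Summable fun j : ℕ => ‖binomHalf j * z ^ j‖ := summable_norm_iff.mpr hsum
  have h1z : 0 < 1 - z := by linarith
  have hsq : L * L = 1 / (1 - z) := by
    rw [hL, tsum_mul_tsum_eq_tsum_sum_antidiagonal_of_summable_norm hnorm hnorm]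
    have e : ∀ n : ℕ, ∑ kl ∈ antidiagonal n, binomHalf kl.1 * z ^ kl.1 * (binomHalf kl.2 * z ^ kl.2) = z ^ n :=
      fun n => by
      calc ∑ kl ∈ antidiagonal n, binomHalf kl.1 * z ^ kl.1 * (binomHalf kl.2 * z ^ kl.2)
          = ∑ kl ∈ antidiagonal n, binomHalf kl.1 * binomHalf kl.2 * z ^ n := by
            refine Finset.sum_congr rfl fun kl hkl => ?_
            rw [← Finset.HasAntidiagonal.mem_antidiagonal.mp hkl, pow_add]
            ring
        _ = z ^ n := by rw [← Finset.sum_mul, sum_antidiagonal_binomHalf, one_mul]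
    simp_rw [e]
    rw [tsum_geometric_of_lt_one hz0 hz1, one_div]
  have hL0 : 0 ≤ L := tsum_nonneg fun j => by have := binomHalf_pos j; positivity
  calc L = Real.sqrt (L * L) := (Real.sqrt_mul_self hL0).symm
    _ = 1 / Real.sqrt (1 - z) := by rw [hsq, one_div, Real.sqrt_inv, one_div]

/-! ### The Laplace–Heine asymptotic -/

/-- `e^{−2nt} P_n(cosh 2t) = S_n(e^{−4t})`. -/
theorem exp_neg_mul_legP_cosh_eq_heineSum (n : ℕ) (t : ℝ) :
    Real.exp (-(2 * (n : ℝ)) * t) * legP n (Real.cosh (2 * t)) = heineSum (Real.exp (-(4 * t))) n := by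
  rw [exp_neg_mul_legP_cosh_eq, heineSum]
  refine Finset.sum_congr rfl fun j _ => ?_
  congr 1
  rw [← Real.exp_nat_mul]
  congr 1
  ring

/-- **THE LAPLACE–HEINE ASYMPTOTIC: `√n · e^{−2nt} · P_n(cosh 2t) → 1/√(π(1 − e^{−4t}))`** for `t > 0`. -/
theorem tendsto_sqrt_mul_exp_neg_mul_legP_cosh {t : ℝ} (ht : 0 < t) :
    Tendsto (fun n : ℕ => Real.sqrt n * (Real.exp (-(2 * (n : ℝ)) * t) * legP n (Real.cosh (2 * t)))) atTop
      (𝓝 (1 / Real.sqrt (Real.pi * (1 - Real.exp (-(4 * t)))))) := by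
  set z := Real.exp (-(4 * t)) with hz
  have hz0 : 0 < z := Real.exp_pos _
  have hz1 : z < 1 := by
    have := Real.exp_lt_exp.mpr (show -(4 * t) < 0 by linarith)
    rwa [Real.exp_zero] at this
  have h1 := tendsto_sqrt_mul_binomHalf
  have h2 := tendsto_heineSum_div hz0 hz1
  rw [tsum_binomHalf_mul_pow hz0.le hz1] at h2
  have h := h1.mul h2
  have hlim : 1 / Real.sqrt Real.pi * (1 / Real.sqrt (1 - z)) = 1 / Real.sqrt (Real.pi * (1 - z)) := by
    rw [Real.sqrt_mul Real.pi_pos.le, one_div_mul_one_div]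
  rw [hlim] at h
  refine h.congr fun n => ?_
  rw [exp_neg_mul_legP_cosh_eq_heineSum, ← hz]
  have ha := (binomHalf_pos n).ne'
  field_simp

section measure

variable [MeasurableSpace Circle] [BorelSpace Circle]

/-- **On the group: `√n · e^{−2nt} · φ_{2n+2}(a_t) → 1/√(π(1 − e^{−4t}))`** for `t > 0` — the sharp asymptotic of the
spherical functions of even integer parameter in the parameter. -/
theorem tendsto_sqrt_mul_exp_neg_mul_sph_even_hyp {t : ℝ} (ht : 0 < t) :
    Tendsto (fun n : ℕ => Real.sqrt n * (Real.exp (-(2 * (n : ℝ)) * t) * sph (2 * (n : ℝ) + 2) (hyp t))) atTop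
      (𝓝 (1 / Real.sqrt (Real.pi * (1 - Real.exp (-(4 * t)))))) := by
  simp only [sph_even_hyp]
  exact tendsto_sqrt_mul_exp_neg_mul_legP_cosh ht

end measure

end Summit.Ventures.HodgeRepro2.T5SU11LegendreLaplaceHeine
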